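import Summits.Ventures.FusionMHD.Bench.SAlphaU067Checks1
import HarnessLib

/-!
# F3 — `s–α` at `(s, α) = (1, 67/100)`: even-solution enclosure transcript, KERNEL CHECK FILE 2/4 (stages 15–29: HOE step test ∧ landing,
# one `decide` per stage)
(venture LADDER-GRIDFUSION, rung F3 — the validated-ODE TWIN of the unstable point `(s, α) = (1, 67/100)` of ★ #192 (TT witness):
instability from a kernel-certified SIGN CHANGE of the even solution through lit-3's conjugate-point socket
`Ballooning.SAlpha.exists_unstableWitnessPW3_of_signChange`; cell `gridfusion`, typed by gridfusion-lit-3 (g13), 2026-08-28; generator =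
lit-3's untrusted Lean-interpreter search `scratch/GenSAlphaChain60u.lean`; 0 `def … : Prop` facts, 0 kit jobs, no `native_decide`, no floating
point.  The per-stage facts are stated through `chain.certAt j` / `chain.initAt (j + 1)` (the transcript's own accessors).)
-/

open NonemptyInterval
open Literature.Analysis.ODE Literature.Analysis.ValidatedNumerics Literature.Analysis.ValidatedNumerics.ITaylor

namespace Summit.Ventures.FusionMHD.Bench.SAlphaU067

/-- Stage 15 of the transcript: the elementary HOE step test AND the landing of its end box in the hand-over box of stage 16 — ONE kernel
evaluation. [cite: Moore1979, §8.1 eq. (8.10) with (8.13)] [cite: NedialkovJacksonCorliss1999, §5 Algorithm I] -/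
theorem uok15 : ((chain.certAt 15).check && boxLE (chain.certAt 15).endBox (chain.initAt 16)) = true := by
  decide +kernel

/-- Stage 15 passes the step test. [cite: Moore1979, §8.1 eq. (8.10) with (8.13)] -/
theorem uok15c : (chain.certAt 15).check = true := (Bool.and_eq_true_iff.1 uok15).1

/-- The end box of stage 15 lands in the hand-over box of stage 16. [cite: NedialkovJacksonCorliss1999, §5 Algorithm I] -/
theorem uok15b : boxLE (chain.certAt 15).endBox (chain.initAt 16) = true := (Bool.and_eq_true_iff.1 uok15).2

/-- Stage 16 of the transcript: the elementary HOE step test AND the landing of its end box in the hand-over box of stage 17 — ONE kernel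
evaluation. [cite: Moore1979, §8.1 eq. (8.10) with (8.13)] [cite: NedialkovJacksonCorliss1999, §5 Algorithm I] -/
theorem uok16 : ((chain.certAt 16).check && boxLE (chain.certAt 16).endBox (chain.initAt 17)) = true := by
  decide +kernel

/-- Stage 16 passes the step test. [cite: Moore1979, §8.1 eq. (8.10) with (8.13)] -/
theorem uok16c : (chain.certAt 16).check = true := (Bool.and_eq_true_iff.1 uok16).1

/-- The end box of stage 16 lands in the hand-over box of stage 17. [cite: NedialkovJacksonCorliss1999, §5 Algorithm I] -/
theorem uok16b : boxLE (chain.certAt 16).endBox (chain.initAt 17) = true := (Bool.and_eq_true_iff.1 uok16).2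

/-- Stage 17 of the transcript: the elementary HOE step test AND the landing of its end box in the hand-over box of stage 18 — ONE kernel
evaluation. [cite: Moore1979, §8.1 eq. (8.10) with (8.13)] [cite: NedialkovJacksonCorliss1999, §5 Algorithm I] -/
theorem uok17 : ((chain.certAt 17).check && boxLE (chain.certAt 17).endBox (chain.initAt 18)) = true := by
  decide +kernel

/-- Stage 17 passes the step test. [cite: Moore1979, §8.1 eq. (8.10) with (8.13)] -/
theorem uok17c : (chain.certAt 17).check = true := (Bool.and_eq_true_iff.1 uok17).1

/-- The end box of stage 17 lands in the hand-over box of stage 18. [cite: NedialkovJacksonCorliss1999, §5 Algorithm I] -/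
theorem uok17b : boxLE (chain.certAt 17).endBox (chain.initAt 18) = true := (Bool.and_eq_true_iff.1 uok17).2

/-- Stage 18 of the transcript: the elementary HOE step test AND the landing of its end box in the hand-over box of stage 19 — ONE kernel
evaluation. [cite: Moore1979, §8.1 eq. (8.10) with (8.13)] [cite: NedialkovJacksonCorliss1999, §5 Algorithm I] -/
theorem uok18 : ((chain.certAt 18).check && boxLE (chain.certAt 18).endBox (chain.initAt 19)) = true := by
  decide +kernel

/-- Stage 18 passes the step test. [cite: Moore1979, §8.1 eq. (8.10) with (8.13)] -/
theorem uok18c : (chain.certAt 18).check = true := (Bool.and_eq_true_iff.1 uok18).1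

/-- The end box of stage 18 lands in the hand-over box of stage 19. [cite: NedialkovJacksonCorliss1999, §5 Algorithm I] -/
theorem uok18b : boxLE (chain.certAt 18).endBox (chain.initAt 19) = true := (Bool.and_eq_true_iff.1 uok18).2

/-- Stage 19 of the transcript: the elementary HOE step test AND the landing of its end box in the hand-over box of stage 20 — ONE kernel
evaluation. [cite: Moore1979, §8.1 eq. (8.10) with (8.13)] [cite: NedialkovJacksonCorliss1999, §5 Algorithm I] -/
theorem uok19 : ((chain.certAt 19).check && boxLE (chain.certAt 19).endBox (chain.initAt 20)) = true := by
  decide +kernel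

/-- Stage 19 passes the step test. [cite: Moore1979, §8.1 eq. (8.10) with (8.13)] -/
theorem uok19c : (chain.certAt 19).check = true := (Bool.and_eq_true_iff.1 uok19).1

/-- The end box of stage 19 lands in the hand-over box of stage 20. [cite: NedialkovJacksonCorliss1999, §5 Algorithm I] -/
theorem uok19b : boxLE (chain.certAt 19).endBox (chain.initAt 20) = true := (Bool.and_eq_true_iff.1 uok19).2

/-- Stage 20 of the transcript: the elementary HOE step test AND the landing of its end box in the hand-over box of stage 21 — ONE kernel
evaluation. [cite: Moore1979, §8.1 eq. (8.10) with (8.13)] [cite: NedialkovJacksonCorliss1999, §5 Algorithm I] -/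
theorem uok20 : ((chain.certAt 20).check && boxLE (chain.certAt 20).endBox (chain.initAt 21)) = true := by
  decide +kernel

/-- Stage 20 passes the step test. [cite: Moore1979, §8.1 eq. (8.10) with (8.13)] -/
theorem uok20c : (chain.certAt 20).check = true := (Bool.and_eq_true_iff.1 uok20).1

/-- The end box of stage 20 lands in the hand-over box of stage 21. [cite: NedialkovJacksonCorliss1999, §5 Algorithm I] -/
theorem uok20b : boxLE (chain.certAt 20).endBox (chain.initAt 21) = true := (Bool.and_eq_true_iff.1 uok20).2

/-- Stage 21 of the transcript: the elementary HOE step test AND the landing of its end box in the hand-over box of stage 22 — ONE kernel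
evaluation. [cite: Moore1979, §8.1 eq. (8.10) with (8.13)] [cite: NedialkovJacksonCorliss1999, §5 Algorithm I] -/
theorem uok21 : ((chain.certAt 21).check && boxLE (chain.certAt 21).endBox (chain.initAt 22)) = true := by
  decide +kernel

/-- Stage 21 passes the step test. [cite: Moore1979, §8.1 eq. (8.10) with (8.13)] -/
theorem uok21c : (chain.certAt 21).check = true := (Bool.and_eq_true_iff.1 uok21).1

/-- The end box of stage 21 lands in the hand-over box of stage 22. [cite: NedialkovJacksonCorliss1999, §5 Algorithm I] -/
theorem uok21b : boxLE (chain.certAt 21).endBox (chain.initAt 22) = true := (Bool.and_eq_true_iff.1 uok21).2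

/-- Stage 22 of the transcript: the elementary HOE step test AND the landing of its end box in the hand-over box of stage 23 — ONE kernel
evaluation. [cite: Moore1979, §8.1 eq. (8.10) with (8.13)] [cite: NedialkovJacksonCorliss1999, §5 Algorithm I] -/
theorem uok22 : ((chain.certAt 22).check && boxLE (chain.certAt 22).endBox (chain.initAt 23)) = true := by
  decide +kernel

/-- Stage 22 passes the step test. [cite: Moore1979, §8.1 eq. (8.10) with (8.13)] -/
theorem uok22c : (chain.certAt 22).check = true := (Bool.and_eq_true_iff.1 uok22).1

/-- The end box of stage 22 lands in the hand-over box of stage 23. [cite: NedialkovJacksonCorliss1999, §5 Algorithm I] -/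
theorem uok22b : boxLE (chain.certAt 22).endBox (chain.initAt 23) = true := (Bool.and_eq_true_iff.1 uok22).2

/-- Stage 23 of the transcript: the elementary HOE step test AND the landing of its end box in the hand-over box of stage 24 — ONE kernel
evaluation. [cite: Moore1979, §8.1 eq. (8.10) with (8.13)] [cite: NedialkovJacksonCorliss1999, §5 Algorithm I] -/
theorem uok23 : ((chain.certAt 23).check && boxLE (chain.certAt 23).endBox (chain.initAt 24)) = true := by
  decide +kernel

/-- Stage 23 passes the step test. [cite: Moore1979, §8.1 eq. (8.10) with (8.13)] -/
theorem uok23c : (chain.certAt 23).check = true := (Bool.and_eq_true_iff.1 uok23).1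

/-- The end box of stage 23 lands in the hand-over box of stage 24. [cite: NedialkovJacksonCorliss1999, §5 Algorithm I] -/
theorem uok23b : boxLE (chain.certAt 23).endBox (chain.initAt 24) = true := (Bool.and_eq_true_iff.1 uok23).2

/-- Stage 24 of the transcript: the elementary HOE step test AND the landing of its end box in the hand-over box of stage 25 — ONE kernel
evaluation. [cite: Moore1979, §8.1 eq. (8.10) with (8.13)] [cite: NedialkovJacksonCorliss1999, §5 Algorithm I] -/
theorem uok24 : ((chain.certAt 24).check && boxLE (chain.certAt 24).endBox (chain.initAt 25)) = true := by
  decide +kernel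

/-- Stage 24 passes the step test. [cite: Moore1979, §8.1 eq. (8.10) with (8.13)] -/
theorem uok24c : (chain.certAt 24).check = true := (Bool.and_eq_true_iff.1 uok24).1

/-- The end box of stage 24 lands in the hand-over box of stage 25. [cite: NedialkovJacksonCorliss1999, §5 Algorithm I] -/
theorem uok24b : boxLE (chain.certAt 24).endBox (chain.initAt 25) = true := (Bool.and_eq_true_iff.1 uok24).2

/-- Stage 25 of the transcript: the elementary HOE step test AND the landing of its end box in the hand-over box of stage 26 — ONE kernel
evaluation. [cite: Moore1979, §8.1 eq. (8.10) with (8.13)] [cite: NedialkovJacksonCorliss1999, §5 Algorithm I] -/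
theorem uok25 : ((chain.certAt 25).check && boxLE (chain.certAt 25).endBox (chain.initAt 26)) = true := by
  decide +kernel

/-- Stage 25 passes the step test. [cite: Moore1979, §8.1 eq. (8.10) with (8.13)] -/
theorem uok25c : (chain.certAt 25).check = true := (Bool.and_eq_true_iff.1 uok25).1

/-- The end box of stage 25 lands in the hand-over box of stage 26. [cite: NedialkovJacksonCorliss1999, §5 Algorithm I] -/
theorem uok25b : boxLE (chain.certAt 25).endBox (chain.initAt 26) = true := (Bool.and_eq_true_iff.1 uok25).2

/-- Stage 26 of the transcript: the elementary HOE step test AND the landing of its end box in the hand-over box of stage 27 — ONE kernel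
evaluation. [cite: Moore1979, §8.1 eq. (8.10) with (8.13)] [cite: NedialkovJacksonCorliss1999, §5 Algorithm I] -/
theorem uok26 : ((chain.certAt 26).check && boxLE (chain.certAt 26).endBox (chain.initAt 27)) = true := by
  decide +kernel

/-- Stage 26 passes the step test. [cite: Moore1979, §8.1 eq. (8.10) with (8.13)] -/
theorem uok26c : (chain.certAt 26).check = true := (Bool.and_eq_true_iff.1 uok26).1

/-- The end box of stage 26 lands in the hand-over box of stage 27. [cite: NedialkovJacksonCorliss1999, §5 Algorithm I] -/
theorem uok26b : boxLE (chain.certAt 26).endBox (chain.initAt 27) = true := (Bool.and_eq_true_iff.1 uok26).2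

/-- Stage 27 of the transcript: the elementary HOE step test AND the landing of its end box in the hand-over box of stage 28 — ONE kernel
evaluation. [cite: Moore1979, §8.1 eq. (8.10) with (8.13)] [cite: NedialkovJacksonCorliss1999, §5 Algorithm I] -/
theorem uok27 : ((chain.certAt 27).check && boxLE (chain.certAt 27).endBox (chain.initAt 28)) = true := by
  decide +kernel

/-- Stage 27 passes the step test. [cite: Moore1979, §8.1 eq. (8.10) with (8.13)] -/
theorem uok27c : (chain.certAt 27).check = true := (Bool.and_eq_true_iff.1 uok27).1

/-- The end box of stage 27 lands in the hand-over box of stage 28. [cite: NedialkovJacksonCorliss1999, §5 Algorithm I] -/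
theorem uok27b : boxLE (chain.certAt 27).endBox (chain.initAt 28) = true := (Bool.and_eq_true_iff.1 uok27).2

/-- Stage 28 of the transcript: the elementary HOE step test AND the landing of its end box in the hand-over box of stage 29 — ONE kernel
evaluation. [cite: Moore1979, §8.1 eq. (8.10) with (8.13)] [cite: NedialkovJacksonCorliss1999, §5 Algorithm I] -/
theorem uok28 : ((chain.certAt 28).check && boxLE (chain.certAt 28).endBox (chain.initAt 29)) = true := by
  decide +kernel

/-- Stage 28 passes the step test. [cite: Moore1979, §8.1 eq. (8.10) with (8.13)] -/
theorem uok28c : (chain.certAt 28).check = true := (Bool.and_eq_true_iff.1 uok28).1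

/-- The end box of stage 28 lands in the hand-over box of stage 29. [cite: NedialkovJacksonCorliss1999, §5 Algorithm I] -/
theorem uok28b : boxLE (chain.certAt 28).endBox (chain.initAt 29) = true := (Bool.and_eq_true_iff.1 uok28).2

/-- Stage 29 of the transcript: the elementary HOE step test AND the landing of its end box in the hand-over box of stage 30 — ONE kernel
evaluation. [cite: Moore1979, §8.1 eq. (8.10) with (8.13)] [cite: NedialkovJacksonCorliss1999, §5 Algorithm I] -/
theorem uok29 : ((chain.certAt 29).check && boxLE (chain.certAt 29).endBox (chain.initAt 30)) = true := by
  decide +kernel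

/-- Stage 29 passes the step test. [cite: Moore1979, §8.1 eq. (8.10) with (8.13)] -/
theorem uok29c : (chain.certAt 29).check = true := (Bool.and_eq_true_iff.1 uok29).1

/-- The end box of stage 29 lands in the hand-over box of stage 30. [cite: NedialkovJacksonCorliss1999, §5 Algorithm I] -/
theorem uok29b : boxLE (chain.certAt 29).endBox (chain.initAt 30) = true := (Bool.and_eq_true_iff.1 uok29).2

end Summit.Ventures.FusionMHD.Bench.SAlphaU067
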